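import Summits.BirchSwinnertonDyer.BirchSwinnertonDyer.Theorems.ManinLocalTwoThreeCDivisionWitnessCore
import Literature.NumberTheory.EllipticCurves.ManinConstantGamma1ModularDegree
import Literature.NumberTheory.EllipticCurves.PeriodLatticeGamma1QuotientProofs
import HarnessLib

/-!
# The `c₁`-division witness on the `X₁(N)`-datum: the CORE package for `Gamma1ParametrizationData`

Cell `bsd-f2-manin`, prover seat p2 (gen 20); crux C2 `ManinOddAtFour` (stmt-BirchSwinnertonDyer-22967) — LEAD p1 g19's DIVISION COVER ON `Γ₁(N)`
(STATUS 2026-08-30T00:08Z): for an `X₁(N)`-parametrisation datum `D₁` of `W` (Manin constant `c₁`, `c₁Λ₁(f) ⊆ Λ_W`) the `c₁`-division point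
`H₁ = E_f mod Λ_W` has `x`-coordinate `℘_{Λ_W}(E_f)`, whose stabiliser in `Γ₀(N)` is EXACTLY `{γ : {∞, γ∞}_f ∈ Λ_W}` — it contains every parabolic; with
UDC (CDT) and Wohlfahrt on `Γ₁(N)` this forces `Λ₁(f) ⊆ Λ_W = c₁Λ₁(f)` for an `X₁`-optimal datum, i.e. `|c₁| = 1` (Stevens), conditionally.  This file
supplies the analytic witness, reusing the datum-free nodes of `…CDivisionPoleKill` / `…CDivisionWitnessCore` (N2 `meromorphicOrderAt_weierstrassP_mul_nonneg`, N3
`exists_invariant_extension_of_cuspSymbol_mem`, N5 `cuspSymbol_mem_of_slash_eq`); the only new input is the pair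
`L″ = (c₁φ(N))⁻¹·Λ_W ⊇ Λ₀(f) ∪ Λ_W` (`φ(N)Λ₀(f) ⊆ Λ₁(f)`, tree `totient_mul_mem_periodLatticeGamma1`) for the integer `x`-presentation:

* `exists_cDivisionWitness_of_presentation` — DATUM-FREE: from any cusp-form presentation of `℘_{L′}(E_f)` and `Λ(L) ⊆ Λ(L′)`, for every `a`,
  a holomorphic `F = 12·℘_L(E_f)·G·Δ^a` off the poles with stabiliser exactly `{γ : {∞,γ∞}_f ∈ Λ(L)}` (the exponent `a` chosen AFTER `G`);
* `periodLattice_le_mulLeft_inv_gamma1`, `lattice_le_mulLeft_inv_gamma1`, `exists_rat_g₂/g₃_mulLeft_inv_gamma1`;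
* `exists_int_isXPresentation_gamma1` — `k ≥ 12`, `F, G ∈ S_k(Γ₀(N))`, `G` with integer coefficients, `IsXPresentation D₁.f L″ F G`;
* `exists_cDivisionWitnessCore_gamma1` — `∃ k G F`, `G ≠ 0` integer cusp form, `F` holomorphic, `F = 12·℘_{Λ_W}(E_f)·G·Δ^a` off the poles, and
  `∀ γ ∈ Γ₀(N), {∞, γ∞}_f ∈ Λ_W ↔ F ∣[k + 12a] γ = F`; `exists_cDivisionWitnessCore_gamma1_natAbs` — the same in the interface of
  `DivisionGamma1.forall_gamma1_division_of_divisionWitness_of_UDW` at `m = |c₁|` (`exists_mem_intCast_mul_eq_natAbs_mul_iff`);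
* `gamma1_f_eq_modular`, `gamma1_lattice_eq_modular`, `gamma1_weierstrassP_eq_modular` — transfer `X₁`-datum ↔ `X₀`-datum of the same `W`.

NOT here: growth at the cusps, the integer `q`-series (Honda at multiplier `1` — NOTE: only the multiplier-`1` division point is `2`-adically integral;
`n²℘_{Λ_W}(n·E_f)` for `n ≥ 2` is not), UDC/Wohlfahrt, and any claim about `c₁`.  Everything is proved (standard axioms); no named fact.
BSD is not proved by this file; C2/C3 and Stevens' conjecture are not proved by this file.
-/

set_option linter.dupNamespace false
set_option autoImplicit false

noncomputable section

open Complex Filter Topology Set Function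
open UpperHalfPlane hiding I
open scoped Real Topology Manifold MatrixGroups PeriodPair ModularForm
open ModularForm SlashInvariantForm ModularFormClass CongruenceSubgroup

open Literature.NumberTheory.EllipticCurves Literature.NumberTheory.EllipticCurves.ModularForms

namespace Summit.BirchSwinnertonDyer.BirchSwinnertonDyer.Theorems.ManinLocalTwoThree.CDivision

variable {N : ℕ} [NeZero N]

/-- `(c₁φ(N))⁻¹ ≠ 0`. [folklore] -/
theorem inv_c_mul_totient_ne_zero {W : WeierstrassCurve ℚ} (D₁ : Gamma1ParametrizationData W N) (hc : (D₁.c : ℂ) ≠ 0) :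
    ((D₁.c : ℂ) * (Nat.totient N : ℂ))⁻¹ ≠ 0 :=
  inv_ne_zero (mul_ne_zero hc (by exact_mod_cast (Nat.totient_pos.mpr (NeZero.pos N)).ne'))

/-- `Λ₀(f) ⊆ (c₁φ(N))⁻¹Λ_W` (`φ(N)Λ₀(f) ⊆ Λ₁(f)` and `c₁Λ₁(f) ⊆ Λ_W`). [cite: LingOesterle1991, Thm. 1] -/
theorem periodLattice_le_mulLeft_inv_gamma1 {W : WeierstrassCurve ℚ} (D₁ : Gamma1ParametrizationData W N)
    (hc : (D₁.c : ℂ) ≠ 0) :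
    ∀ x ∈ periodLattice D₁.f,
      x ∈ (D₁.L.mulLeft (((D₁.c : ℂ) * (Nat.totient N : ℂ))⁻¹) (inv_c_mul_totient_ne_zero D₁ hc)).lattice := by
  intro x hx
  rw [PeriodPair.mem_mulLeft_lattice, inv_inv, mul_assoc]
  exact D₁.smul_periodLatticeGamma1_le _ (totient_mul_mem_periodLatticeGamma1 D₁.f hx)

/-- `Λ_W ⊆ (c₁φ(N))⁻¹Λ_W`. [folklore] -/
theorem lattice_le_mulLeft_inv_gamma1 {W : WeierstrassCurve ℚ} (D₁ : Gamma1ParametrizationData W N) (hc : (D₁.c : ℂ) ≠ 0) :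
    ∀ z ∈ D₁.L.lattice,
      z ∈ (D₁.L.mulLeft (((D₁.c : ℂ) * (Nat.totient N : ℂ))⁻¹) (inv_c_mul_totient_ne_zero D₁ hc)).lattice := by
  intro z hz
  rw [PeriodPair.mem_mulLeft_lattice, inv_inv]
  have := zsmul_mem hz (D₁.c * (Nat.totient N : ℤ))
  simpa [zsmul_eq_mul] using this

/-- `g₂((c₁φ(N))⁻¹Λ_W) ∈ ℚ`. [folklore] -/
theorem exists_rat_g₂_mulLeft_inv_gamma1 {W : WeierstrassCurve ℚ} (D₁ : Gamma1ParametrizationData W N) (hc : (D₁.c : ℂ) ≠ 0) :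
    ∃ q : ℚ, (q : ℂ) = (D₁.L.mulLeft (((D₁.c : ℂ) * (Nat.totient N : ℂ))⁻¹) (inv_c_mul_totient_ne_zero D₁ hc)).g₂ := by
  refine ⟨((D₁.c : ℚ) * Nat.totient N) ^ 4 * (W.c₄ / 12), ?_⟩
  rw [PeriodPair.g₂_mulLeft, D₁.isNeronLattice.1, inv_pow, inv_inv]
  simp only [WeierstrassCurve.baseChange, WeierstrassCurve.map_c₄, eq_ratCast]
  push_cast
  ring

/-- `g₃((c₁φ(N))⁻¹Λ_W) ∈ ℚ`. [folklore] -/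
theorem exists_rat_g₃_mulLeft_inv_gamma1 {W : WeierstrassCurve ℚ} (D₁ : Gamma1ParametrizationData W N) (hc : (D₁.c : ℂ) ≠ 0) :
    ∃ q : ℚ, (q : ℂ) = (D₁.L.mulLeft (((D₁.c : ℂ) * (Nat.totient N : ℂ))⁻¹) (inv_c_mul_totient_ne_zero D₁ hc)).g₃ := by
  refine ⟨((D₁.c : ℚ) * Nat.totient N) ^ 6 * (W.c₆ / 216), ?_⟩
  rw [PeriodPair.g₃_mulLeft, D₁.isNeronLattice.2, inv_pow, inv_inv]
  simp only [WeierstrassCurve.baseChange, WeierstrassCurve.map_c₆, eq_ratCast]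
  push_cast
  ring

/-- **Integer `x`-presentation for the `X₁(N)`-datum**: `k ≥ 12`, `F, G ∈ S_k(Γ₀(N))`, `aₘ(G) ∈ ℤ`, presenting `℘_{(c₁φ(N))⁻¹Λ_W}(E_f)`.
[cite: ShimuraIATAF1971, Thm. 3.52 and Thm. 7.14] -/
theorem exists_int_isXPresentation_gamma1 {W : WeierstrassCurve ℚ} (D₁ : Gamma1ParametrizationData W N)
    (hc : (D₁.c : ℂ) ≠ 0) :
    ∃ (k : ℤ) (F G : CuspForm (Gamma0 N) k), 12 ≤ k ∧
      IsXPresentation D₁.f (D₁.L.mulLeft (((D₁.c : ℂ) * (Nat.totient N : ℂ))⁻¹) (inv_c_mul_totient_ne_zero D₁ hc)) F G ∧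
      ∀ m, ∃ z : ℤ, cuspCoeff G m = z := by
  have hf : D₁.f ≠ 0 := D₁.isNewformOf.1.ne_zero
  have hrat : ∀ m, ∃ q : ℚ, (q : ℂ) = cuspCoeff D₁.f m := fun m ↦
    ⟨W.LFunction m, by rw [D₁.isNewformOf.2 m]; push_cast; rfl⟩
  obtain ⟨k, F, G, Dn, hk, hX, hDn, hDint⟩ :=
    DepletionAtTwo.X1RatPres.exists_rat_isXPresentation D₁.f hf hrat _ (periodLattice_le_mulLeft_inv_gamma1 D₁ hc)
      (exists_rat_g₂_mulLeft_inv_gamma1 D₁ hc) (exists_rat_g₃_mulLeft_inv_gamma1 D₁ hc)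
  have hDn0 : (Dn : ℂ) ≠ 0 := by exact_mod_cast hDn.ne'
  refine ⟨k, (Dn : ℂ) • F, (Dn : ℂ) • G, hk, isXPresentation_smul hX hDn0, fun m ↦ ?_⟩
  obtain ⟨z, hz⟩ := hDint m
  exact ⟨z, by rw [cuspCoeff_smul, hz]⟩

/-! ### The witness from a presentation (datum-free) -/

/-- **The `c`-division witness from an integer presentation (DATUM-FREE).**  Let `f ≠ 0`, `Λ(L) ⊆ Λ(L′)` period pairs, `(Fx, G)` a
presentation of `℘_{L′}(E_f)` by cusp forms of weight `k ≥ 0`, and `a : ℕ`.  Then there is a holomorphic `F : ℍ → ℂ` with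
`F = 12·℘_L(E_f)·G·Δ^a` off the poles of `℘_L(E_f)` and, for `γ ∈ Γ₀(N)`, `{∞, γ∞}_f ∈ Λ(L) ↔ F ∣[k + 12a] γ = F` (N2 pole killing, N3 invariant
extension, N5 Manin's lemma of `…CDivisionPoleKill`).  Serves the `X₀`-datum (`L = Λ_W`, `L′ = c⁻¹Λ_W`) and the `X₁`-datum (`L′ = (c₁φ(N))⁻¹Λ_W`)
alike, with the exponent `a` chosen AFTER `G` (as node (N6) requires). [cite: Manin1972, Prop. 1.4] -/
theorem exists_cDivisionWitness_of_presentation (f : CuspForm (Gamma0 N) 2) (hf : f ≠ 0) {L L' : PeriodPair}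
    (hLL' : ∀ z ∈ L.lattice, z ∈ L'.lattice) {k : ℤ} (hk : 0 ≤ k) {Fx G : CuspForm (Gamma0 N) k} (hX : IsXPresentation f L' Fx G) (a : ℕ) :
    ∃ F : ℍ → ℂ, MDifferentiable 𝓘(ℂ) 𝓘(ℂ) F ∧
      (∀ τ : ℍ, eichlerIntegral f τ ∉ L.lattice → 12 * ℘[L] (eichlerIntegral f τ) * G τ * ModularForm.discriminant τ ^ a = F τ) ∧
      (∀ γ : Gamma0 N, cuspSymbol f γ ∈ L.lattice ↔ F ∣[k + 12 * a] (γ : SL(2, ℤ)) = F) := by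
  set K : ℕ := k.toNat + 12 * a with hKdef
  have hK : (K : ℤ) = k + 12 * a := by
    rw [hKdef]; push_cast; rw [Int.toNat_of_nonneg hk]
  set Gt : ℍ → ℂ := fun τ ↦ 12 * G τ * ModularForm.discriminant τ ^ a with hGt
  have hGan : AnalyticOnNhd ℂ (Gt ∘ ofComplex) {z : ℂ | 0 < z.im} :=
    analyticOnNhd_twelve_mul_mul_discriminant_pow G a
  have hGsmul : ∀ γ : SL(2, ℤ), γ ∈ Gamma0 N → ∀ τ : ℍ, Gt (γ • τ) = denom γ τ ^ K * Gt τ :=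
    fun γ hγ τ ↦ twelve_mul_mul_discriminant_pow_apply_smul G a K hK γ hγ τ
  have hkill : ∀ z : ℂ, 0 < z.im → eichlerIntegral f (ofComplex z) ∈ L.lattice →
      0 ≤ meromorphicOrderAt ((fun w : ℂ ↦ ℘[L] (eichlerIntegral f (ofComplex w))) * (Gt ∘ ofComplex)) z := by
    intro z hz hzL
    have hΔan : AnalyticAt ℂ (fun w : ℂ ↦ (12 : ℂ) * (ModularForm.discriminant ∘ ofComplex) w ^ a) z :=
      analyticAt_const.mul ((analyticOnNhd_discriminant_comp_ofComplex z hz).pow a)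
    have hGan' : AnalyticAt ℂ (⇑G ∘ ofComplex) z :=
      (UpperHalfPlane.mdifferentiable_iff.mp G.holo').analyticAt (isOpen_upperHalfPlaneSet.mem_nhds hz)
    have hXm : MeromorphicAt (fun w : ℂ ↦ ℘[L] (eichlerIntegral f (ofComplex w))) z :=
      meromorphicAt_weierstrassP_eichlerIntegral f L hz
    have hsplit : ((fun w : ℂ ↦ ℘[L] (eichlerIntegral f (ofComplex w))) * (Gt ∘ ofComplex)) =
        ((fun w : ℂ ↦ ℘[L] (eichlerIntegral f (ofComplex w))) * (⇑G ∘ ofComplex)) *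
          fun w : ℂ ↦ (12 : ℂ) * (ModularForm.discriminant ∘ ofComplex) w ^ a := by
      funext w
      simp only [Pi.mul_apply, comp_apply, hGt]
      ring
    rw [hsplit, meromorphicOrderAt_mul (hXm.mul hGan'.meromorphicAt) hΔan.meromorphicAt]
    exact add_nonneg (meromorphicOrderAt_weierstrassP_mul_nonneg f hf hX hLL' hz hzL) hΔan.meromorphicOrderAt_nonneg
  obtain ⟨F, hFmd, hFinv, hFeq⟩ := exists_invariant_extension_of_cuspSymbol_mem f hf L Gt K hGan hGsmul hkill
  have hGtmd : MDifferentiable 𝓘(ℂ) 𝓘(ℂ) Gt := UpperHalfPlane.mdifferentiable_iff.mpr hGan.differentiableOn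
  have hGt1 : ∃ τ₁ : ℍ, Gt τ₁ ≠ 0 := by
    obtain ⟨τ₁, hτ₁⟩ := DFunLike.ne_iff.mp hX.1
    refine ⟨τ₁, mul_ne_zero (mul_ne_zero (by norm_num) ?_) (pow_ne_zero _ (ModularForm.discriminant_ne_zero τ₁))⟩
    simpa using hτ₁
  refine ⟨F, hFmd, fun τ hτ ↦ ?_, fun γ ↦ ⟨fun hγ ↦ ?_, fun hγ ↦ ?_⟩⟩
  · rw [← hFeq τ hτ, hGt]
    ring
  · rw [← hK]
    exact hFinv γ hγ
  · rw [← hK] at hγ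
    exact cuspSymbol_mem_of_slash_eq f hf L Gt F K hGtmd hGt1 γ (hGsmul (γ : SL(2, ℤ)) γ.2) hFeq hγ

/-! ### The `X₁(N)`-datum core -/

/-- **The core of the `c₁`-division witness on the `X₁(N)`-datum.**  For `D₁ : Gamma1ParametrizationData W N` with `c₁ ≠ 0` and `a : ℕ`:
`k ≥ 12`, `G ∈ S_k(Γ₀(N))` nonzero with integer coefficients, `F : ℍ → ℂ` holomorphic with `F = 12·℘_{Λ_W}(E_f)·G·Δ^a` off the poles and,
for every `γ ∈ Γ₀(N)`, `{∞, γ∞}_f ∈ Λ_W ↔ F ∣[k + 12a] γ = F`. [cite: ShimuraIATAF1971, Thm. 3.52 and Thm. 7.14] [cite: Manin1972, Prop. 1.4] -/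
theorem exists_cDivisionWitnessCore_gamma1 {W : WeierstrassCurve ℚ} (D₁ : Gamma1ParametrizationData W N)
    (hc : (D₁.c : ℂ) ≠ 0) (a : ℕ) :
    ∃ (k : ℤ) (G : CuspForm (Gamma0 N) k) (F : ℍ → ℂ), 12 ≤ k ∧ G ≠ 0 ∧ (∀ m, ∃ z : ℤ, cuspCoeff G m = z) ∧
      MDifferentiable 𝓘(ℂ) 𝓘(ℂ) F ∧
      (∀ τ : ℍ, eichlerIntegral D₁.f τ ∉ D₁.L.lattice →
        12 * ℘[D₁.L] (eichlerIntegral D₁.f τ) * G τ * ModularForm.discriminant τ ^ a = F τ) ∧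
      (∀ γ : Gamma0 N, cuspSymbol D₁.f γ ∈ D₁.L.lattice ↔ F ∣[k + 12 * a] (γ : SL(2, ℤ)) = F) := by
  have hf : D₁.f ≠ 0 := D₁.isNewformOf.1.ne_zero
  obtain ⟨k, Fx, G, hk, hX, hint⟩ := exists_int_isXPresentation_gamma1 D₁ hc
  obtain ⟨F, hF, hFeq, hiff⟩ :=
    exists_cDivisionWitness_of_presentation D₁.f hf (lattice_le_mulLeft_inv_gamma1 D₁ hc) (by omega) hX a
  exact ⟨k, G, F, hk, hX.1, hint, hF, hFeq, hiff⟩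

/-! ### The interface of `…DivisionCoverGamma1UDC` at `m = |c₁|` -/

/-- For `c ≠ 0`: `(∃ ν ∈ Λ, c·s = |c|·ν) ↔ s ∈ Λ` (`c = ±|c|`, `Λ = −Λ`). [folklore] -/
theorem exists_mem_intCast_mul_eq_natAbs_mul_iff (L : PeriodPair) {c : ℤ} (hc : c ≠ 0) (s : ℂ) :
    (∃ ν ∈ L.lattice, (c : ℂ) * s = (c.natAbs : ℂ) * ν) ↔ s ∈ L.lattice := by
  have hcC : (c.natAbs : ℂ) ≠ 0 := by exact_mod_cast Int.natAbs_ne_zero.mpr hc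
  rcases Int.natAbs_eq c with h | h
  · have hcast : (c : ℂ) = (c.natAbs : ℂ) := by rw [h]; simp
    rw [hcast]
    constructor
    · rintro ⟨ν, hν, hνeq⟩
      have : s = ν := mul_left_cancel₀ hcC hνeq
      rw [this]; exact hν
    · intro hs
      exact ⟨s, hs, rfl⟩
  · have hcast : (c : ℂ) = -(c.natAbs : ℂ) := by rw [h]; simp
    rw [hcast]
    constructor
    · rintro ⟨ν, hν, hνeq⟩
      have : s = -ν := by
        have h' : (c.natAbs : ℂ) * s = (c.natAbs : ℂ) * (-ν) := by rw [mul_neg, ← hνeq]; ring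
        exact mul_left_cancel₀ hcC h'
      rw [this]; exact neg_mem hν
    · intro hs
      exact ⟨-s, neg_mem hs, by ring⟩

/-- **The `c₁`-division witness core in the shape of `DivisionGamma1.forall_gamma1_division_of_divisionWitness_of_UDW` at `m := |c₁|`**
(so that NO divisibility hypothesis is needed and the division point is the multiplier-`1` point `E_f mod Λ_W`, whose `q`-series IS integral):
for `D₁ : Gamma1ParametrizationData W N` and `a : ℕ` there are `k ≥ 12`, an integer cusp form `G ≠ 0` and a holomorphic `F` with
`F = 12·℘_{Λ_W}(E_f)·G·Δ^a` off the poles, such that for `γ ∈ Γ₁(N)`: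
`(∃ ν ∈ Λ_W, c₁·{∞,γ∞}_f = |c₁|·ν) → F ∣[k+12a] γ = F` and conversely.  With UDC (CDT), Wohlfahrt-in-`Γ₁` (`…DivisionCoverGamma1UDC` §1–§4 at
`m = |c₁|`) and optimality this yields `Λ₁(f) ⊆ Λ_W = c₁Λ₁(f)`, i.e. `|c₁| = 1` — ONCE the growth (N6) and integer `q`-series (N7, Honda at `1`)
of THIS `F` are supplied.  Nothing about `c₁` is proved here. [cite: ShimuraIATAF1971, Thm. 3.52 and Thm. 7.14] [cite: Manin1972, Prop. 1.4] -/
theorem exists_cDivisionWitnessCore_gamma1_natAbs {W : WeierstrassCurve ℚ} (D₁ : Gamma1ParametrizationData W N) (a : ℕ) :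
    ∃ (k : ℤ) (G : CuspForm (Gamma0 N) k) (F : ℍ → ℂ), 12 ≤ k ∧ G ≠ 0 ∧ (∀ m, ∃ z : ℤ, cuspCoeff G m = z) ∧
      MDifferentiable 𝓘(ℂ) 𝓘(ℂ) F ∧
      (∀ τ : ℍ, eichlerIntegral D₁.f τ ∉ D₁.L.lattice →
        12 * ℘[D₁.L] (eichlerIntegral D₁.f τ) * G τ * ModularForm.discriminant τ ^ a = F τ) ∧
      (∀ γ : Gamma1 N, (∃ ν ∈ D₁.L.lattice,
        (D₁.c : ℂ) * cuspSymbol D₁.f ⟨(γ : SL(2, ℤ)), Gamma1_in_Gamma0 N γ.2⟩ = (D₁.c.natAbs : ℂ) * ν) →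
        F ∣[k + 12 * a] (γ : SL(2, ℤ)) = F) ∧
      (∀ γ : Gamma1 N, F ∣[k + 12 * a] (γ : SL(2, ℤ)) = F → ∃ ν ∈ D₁.L.lattice,
        (D₁.c : ℂ) * cuspSymbol D₁.f ⟨(γ : SL(2, ℤ)), Gamma1_in_Gamma0 N γ.2⟩ = (D₁.c.natAbs : ℂ) * ν) := by
  have hc0 : D₁.c ≠ 0 := D₁.maninConstant_ne_zero
  have hc : (D₁.c : ℂ) ≠ 0 := Int.cast_ne_zero.mpr hc0
  obtain ⟨k, G, F, hk, hG, hint, hF, hFeq, hiff⟩ := exists_cDivisionWitnessCore_gamma1 D₁ hc a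
  refine ⟨k, G, F, hk, hG, hint, hF, hFeq, fun γ hγ ↦ ?_, fun γ hγ ↦ ?_⟩
  · exact (hiff ⟨(γ : SL(2, ℤ)), Gamma1_in_Gamma0 N γ.2⟩).mp
      ((exists_mem_intCast_mul_eq_natAbs_mul_iff D₁.L hc0 _).mp hγ)
  · exact (exists_mem_intCast_mul_eq_natAbs_mul_iff D₁.L hc0 _).mpr
      ((hiff ⟨(γ : SL(2, ℤ)), Gamma1_in_Gamma0 N γ.2⟩).mpr hγ)

/-! ### Transfer between the `X₀`- and the `X₁`-datum of the same curve (for the nodes stated on `ModularParametrizationData`) -/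

/-- An `X₁(N)`-datum and an `X₀(N)`-datum of the same `W` have the same newform (`q`-expansion principle). [folklore] -/
theorem gamma1_f_eq_modular {W : WeierstrassCurve ℚ} (D₁ : Gamma1ParametrizationData W N)
    (D : ModularParametrizationData W N) : D₁.f = D.f :=
  D₁.isNewformOf.unique D.isNewformOf

/-- … and the same Néron lattice (uniqueness half of the Uniformization Theorem). [cite: SilvermanAEC2009, Thm. VI.5.1] -/
theorem gamma1_lattice_eq_modular {W : WeierstrassCurve ℚ} (D₁ : Gamma1ParametrizationData W N)
    (D : ModularParametrizationData W N) : D₁.L.lattice = D.L.lattice :=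
  PeriodPair.uniformization_unique_holds _ _ (D₁.isNeronLattice.1.trans D.isNeronLattice.1.symm)
    (D₁.isNeronLattice.2.trans D.isNeronLattice.2.symm)

/-- … hence the same `℘` (so every statement about `℘_{Λ_W}(E_f)`, `E_f ∈ Λ_W` proved for the `X₀`-datum — e.g. the cusp series (N7) and the
growth (N6) — transfers verbatim to the `X₁`-datum). [folklore] -/
theorem gamma1_weierstrassP_eq_modular {W : WeierstrassCurve ℚ} (D₁ : Gamma1ParametrizationData W N)
    (D : ModularParametrizationData W N) : ℘[D₁.L] = ℘[D.L] :=
  PeriodPair.weierstrassP_eq_of_lattice_eq (gamma1_lattice_eq_modular D₁ D)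

end Summit.BirchSwinnertonDyer.BirchSwinnertonDyer.Theorems.ManinLocalTwoThree.CDivision

end
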